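import Summits.QuantumFields.YangMills.Theorems.EquipartitionCriticalityEquipartitionPinsProbeTangentShiftDerivFieldBasic
import HarnessLib

/-!
# Derivative of the rescaled plaquette field along a conjugated one-link shift

Crux `stmt-QuantumFields-8760` (`EquipartitionPinsProbe`), line `Sketch`, stub `stub_shiftDerivField`
(TS3) of the reshaped `stub_tangentCore`.

Fix a lattice representation `r` of a compact group `G`, a frame index `b`, `X = e_b = lieVec r b`
(skew-Hermitian, `‖X‖_F = 1`) and a one-parameter subgroup `k : ℝ → G` with `ρ(k_t) = exp(tX)`.
For a configuration `U` on `ℤ⁴` and an edge `e = (x, i)` consider the two one-link shifted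
configurations of the skew Haar shift,

* LEFT:  `T_t U = U[e ↦ G_U(x)⁻¹ k_t G_U(x) U_e]` (used for non-comb `e`, and comb `e` with `x_i ≥ 0`),
* RIGHT: `T_t U = U[e ↦ U_e G_U(x+e_i)⁻¹ k_t⁻¹ G_U(x+e_i)]` (comb `e` with `x_i < 0`),

`G_U` the comb transport. By the neighbour stub `stub_combShift` (taken here as the hypothesis
`hTS0`) the comb transport of `T_t U` is `k_t^{s(y)} G_U(y)` with `s` the indicator of the shadow of
`e`; hence every gauge-fixed link `Ũ_{e'}`, `e' = (y, j) ≠ e`, moves as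
`ρ(Ũ_{e'}(t)) = exp(tX)^{s(y)} ρ(Ũ_{e'}) exp(−tX)^{s(y + e_j)}`, while `Ũ_e(t) = 1` (comb `e`) or
`ρ(Ũ_e(t)) = exp(tX) ρ(Ũ_e)` (non-comb `e`). Differentiating the Frobenius coordinates
`Re tr(· e_a†)` at `t = 0` (companion file `…TangentShiftDerivFieldBasic`) gives for the rescaled
link field the derivative `√β ω(e')`, `ω = m δ_ab + err`, `m = ±δ_e − ds`,
`|err_{e'}| ≤ 2 ‖ρ(Ũ_{e'}) − 1‖_F`; the curl of the gradient `ds` vanishes identically, so the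
rescaled plaquette field `Y = dA` has derivative `√β (±δ_ab (dδ_e)_p + err_p)` with
`err_p² ≤ 4 Σ_i err_i² ≤ 32 Σ_i (N − Re tr ρ(Ũ_{∂_i p}))`.

The assembly lemma `TangentShiftDerivField.assembly` (general main-term cochain `m`) is shared by the
three cases `left_of_isComb`, `left_of_not_isComb`, `right_of_isComb`.

References: S. Chatterjee, arXiv:1602.01222, §§9–11; B. C. Hall, GTM 222 (2015), Thm. 3.20.
-/

noncomputable section

open scoped Matrix Matrix.Norms.Frobenius
open Literature.Probability.LatticeModels Literature.MathematicalPhysics.QuantumLattice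
open Literature.MathematicalPhysics.QuantumFieldTheory

namespace Summit.QuantumFields.YangMills.Theorems.EquipartitionPinsProbe

namespace TangentShiftDerivField

section Assembly

variable {G : Type} [Group G] [TopologicalSpace G] (r : LatticeRep G) (b : Fin (lieDim r)) {k : ℝ → G}
  (hk : ∀ t : ℝ, r.ρ (k t) = NormedSpace.exp ((t : ℂ) • lieVec r b))
include hk

/-- **Assembly**: if along `t ↦ W t` every gauge-fixed link `e' ≠ e` is conjugated by the optional
shifts indexed by `S` at its endpoints and the gauge-fixed link `e` is left-multiplied by the optional
shift indexed by `Pe`, and `m` is the cochain `[Pe]` at `e`, `[S](y) − [S](y + e_j)` at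
`(y, j) ≠ e`, then the rescaled plaquette field has derivative `√β (δ_ab (dm)_p + err_p)` at `t = 0`
with `err_p² ≤ 32 Σ_i (N − Re tr ρ(Ũ_{∂_i p}))`. -/
theorem assembly [CompactSpace G] (U : LGConfig 4 G) (e : Literature.MathematicalPhysics.QuantumLattice.ZdEdge 4)
    (W : ℝ → LGConfig 4 G) (S : Site 4 → Prop) [DecidablePred S] (Pe : Prop) [Decidable Pe]
    (m : Literature.MathematicalPhysics.QuantumLattice.ZdEdge 4 → ℝ)
    (hA : ∀ (t : ℝ) (e' : Literature.MathematicalPhysics.QuantumLattice.ZdEdge 4), e' ≠ e →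
      axialFix (W t) e' = (if S e'.1 then k t else 1) * axialFix U e' *
        (if S (e'.1 + Pi.single e'.2 1) then k t else 1)⁻¹)
    (hB : ∀ t : ℝ, axialFix (W t) e = (if Pe then k t else 1) * axialFix U e)
    (hme : m e = if Pe then 1 else 0)
    (hmne : ∀ e' : Literature.MathematicalPhysics.QuantumLattice.ZdEdge 4, e' ≠ e →
      m e' = (if S e'.1 then 1 else 0) - (if S (e'.1 + Pi.single e'.2 1) then 1 else 0))
    (β : ℝ) (p : ZdPlaquette 4) (a : Fin (lieDim r)) :
    ∃ err : ℝ, HasDerivAt (fun t => plaqField r β (W t) p a)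
        (Real.sqrt β * ((if a = b then plaquetteCurl m p else 0) + err)) 0 ∧
      err ^ 2 ≤ 32 * ∑ i : Fin 4, ((r.N : ℝ) - (r.ρ (axialFix U (plaquetteBoundary p i))).trace.re) := by
  -- the Kronecker delta `Re tr(e_b e_a†) = δ_ab`
  have hδ : lieCoord r (lieVec r b) a = if a = b then 1 else 0 :=
    ((stub_lieFrame G r).1 b a).trans (if_congr eq_comm rfl rfl)
  -- the error cochain
  obtain ⟨err, herr⟩ : ∃ err : Literature.MathematicalPhysics.QuantumLattice.ZdEdge 4 → ℝ, err = fun e' =>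
      if e' = e then
        (if Pe then (1 : ℝ) else 0) * lieCoord r (lieVec r b * (r.ρ (axialFix U e) - 1)) a -
          0 * lieCoord r ((r.ρ (axialFix U e) - 1) * lieVec r b) a
      else
        (if S e'.1 then (1 : ℝ) else 0) * lieCoord r (lieVec r b * (r.ρ (axialFix U e') - 1)) a -
          (if S (e'.1 + Pi.single e'.2 1) then (1 : ℝ) else 0) *
            lieCoord r ((r.ρ (axialFix U e') - 1) * lieVec r b) a := ⟨_, rfl⟩
  -- per-link derivatives
  have hlink : ∀ e', HasDerivAt (fun t => linkField r β (W t) e' a)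
      (Real.sqrt β * (m e' * (if a = b then 1 else 0) + err e')) 0 := by
    intro e'
    unfold linkField
    rcases eq_or_ne e' e with hee | hne
    · rw [hee]
      have h := hasDerivAt_link r b hk Pe False (axialFix U e) a
      simp only [if_false, inv_one, mul_one, sub_zero] at h
      simp only [hB]
      refine (h.const_mul (Real.sqrt β)).congr_deriv ?_
      rw [herr, hme]
      simp only [if_true, hδ]
    · have hA' : ∀ t, axialFix (W t) e' = (if S e'.1 then k t else 1) * axialFix U e' *
          (if S (e'.1 + Pi.single e'.2 1) then k t else 1)⁻¹ := fun t => hA t e' hne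
      have h := hasDerivAt_link r b hk (S e'.1) (S (e'.1 + Pi.single e'.2 1)) (axialFix U e') a
      simp only [hA']
      refine (h.const_mul (Real.sqrt β)).congr_deriv ?_
      rw [herr, hmne e' hne]
      simp only [if_neg hne, hδ]
  -- the plaquette field is the curl of the link field
  have hplaq := hasDerivAt_plaquetteCurl hlink p
  refine ⟨plaquetteCurl err p, ?_, ?_⟩
  · have hval : plaquetteCurl (fun e' => Real.sqrt β * (m e' * (if a = b then 1 else 0) + err e')) p =
        Real.sqrt β * ((if a = b then plaquetteCurl m p else 0) + plaquetteCurl err p) := by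
      rw [plaquetteCurl_linComb]
      congr 2
      split_ifs <;> simp
    exact hplaq.congr_deriv hval
  · -- the error bound
    have hterm : ∀ e', (err e') ^ 2 ≤ 8 * ((r.N : ℝ) - (r.ρ (axialFix U e')).trace.re) := by
      intro e'
      rw [herr]
      by_cases h : e' = e
      · have h0 : |(0 : ℝ)| ≤ 1 := by simp
        have h1 : |(if Pe then (1 : ℝ) else 0)| ≤ 1 := by split_ifs <;> simp
        simp only [h, if_true]
        exact err_sq_le r b h1 h0 _ a
      · have h1 : |(if S e'.1 then (1 : ℝ) else 0)| ≤ 1 := by split_ifs <;> simp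
        have h2 : |(if S (e'.1 + Pi.single e'.2 1) then (1 : ℝ) else 0)| ≤ 1 := by split_ifs <;> simp
        simp only [if_neg h]
        exact err_sq_le r b h1 h2 _ a
    calc (plaquetteCurl err p) ^ 2 ≤ 4 * ∑ i : Fin 4, (err (plaquetteBoundary p i)) ^ 2 :=
          plaquetteCurl_sq_le err p
      _ ≤ 4 * ∑ i : Fin 4, (8 * ((r.N : ℝ) - (r.ρ (axialFix U (plaquetteBoundary p i))).trace.re)) :=
          mul_le_mul_of_nonneg_left (Finset.sum_le_sum fun i _ => hterm _) (by norm_num)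
      _ = 32 * ∑ i : Fin 4, ((r.N : ℝ) - (r.ρ (axialFix U (plaquetteBoundary p i))).trace.re) := by
          rw [← Finset.mul_sum]; ring

/-- **LEFT family, comb edge with `x_i ≥ 0`** (`m = δ_e − ds`; the comb transport of the shifted
configuration is supplied as the hypothesis `hGW`, from the neighbour stub `stub_combShift`). -/
theorem left_of_isComb [CompactSpace G] (U : LGConfig 4 G) (e : Literature.MathematicalPhysics.QuantumLattice.ZdEdge 4)
    (hc : ∀ j : Fin 4, e.2 < j → e.1 j = 0) (hx : 0 ≤ e.1 e.2)
    (hGW : ∀ (t : ℝ) (y : Site 4), combTransport (Function.update U e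
      ((combTransport U e.1)⁻¹ * k t * combTransport U e.1 * U e)) y =
        (if y ∈ shadow e then k t else 1) * combTransport U y)
    (β : ℝ) (p : ZdPlaquette 4) (a : Fin (lieDim r)) :
    ∃ err : ℝ, HasDerivAt (fun t : ℝ => plaqField r β (Function.update U e
        ((combTransport U e.1)⁻¹ * k t * combTransport U e.1 * U e)) p a)
        (Real.sqrt β * ((if a = b then plaquetteCurl (fun e' => if e' = e then (1 : ℝ) else 0) p else 0) + err)) 0 ∧
      err ^ 2 ≤ 32 * ∑ i : Fin 4, ((r.N : ℝ) - (r.ρ (axialFix U (plaquetteBoundary p i))).trace.re) := by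
  have hx0 : e.1 ∉ shadow e := fun h => by
    have h' := h.2.2.1 hx
    omega
  have hx1 : e.1 + Pi.single e.2 1 ∈ shadow e :=
    ⟨hc, fun j hj => by rw [Pi.add_apply, Pi.single_eq_of_ne (ne_of_lt hj), add_zero],
      fun _ => by rw [Pi.add_apply, Pi.single_eq_same], fun h => absurd hx (not_le.2 h)⟩
  obtain ⟨err, hd, hb⟩ := assembly r b hk U e
    (fun t => Function.update U e ((combTransport U e.1)⁻¹ * k t * combTransport U e.1 * U e))
    (· ∈ shadow e) False
    (fun e' => (if e' = e then (1 : ℝ) else 0) -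
      ((if e'.1 + Pi.single e'.2 1 ∈ shadow e then (1 : ℝ) else 0) - (if e'.1 ∈ shadow e then 1 else 0)))
    (fun t e' hne => by
      rw [CombBasics.axialFix_apply, CombBasics.axialFix_apply, hGW, hGW, Function.update_of_ne hne]
      group)
    (fun t => by
      have h1 : axialFix (Function.update U e ((combTransport U e.1)⁻¹ * k t * combTransport U e.1 * U e)) e = 1 := by
        rw [CombBasics.axialFix_apply, hGW, hGW, Function.update_self, if_neg hx0, if_pos hx1,
          CombBasics.combTransport_add_single U hc]
        simp only [Prod.mk.eta]
        group
      rw [h1, CombBasics.axialFix_of_isComb U hc]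
      simp)
    (by simp [hx0, hx1])
    (fun e' hne => by simp only [if_neg hne]; ring)
    β p a
  refine ⟨err, hd.congr_deriv ?_, hb⟩
  rw [plaquetteCurl_sub, plaquetteCurl_gradient (fun y => if y ∈ shadow e then (1 : ℝ) else 0) p, sub_zero]

/-- **LEFT family, non-comb edge** (`m = δ_e`; the comb transport does not see the shifted link). -/
theorem left_of_not_isComb [CompactSpace G] (U : LGConfig 4 G) (e : Literature.MathematicalPhysics.QuantumLattice.ZdEdge 4)
    (hnc : ¬ ∀ j : Fin 4, e.2 < j → e.1 j = 0)
    (β : ℝ) (p : ZdPlaquette 4) (a : Fin (lieDim r)) :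
    ∃ err : ℝ, HasDerivAt (fun t : ℝ => plaqField r β (Function.update U e
        ((combTransport U e.1)⁻¹ * k t * combTransport U e.1 * U e)) p a)
        (Real.sqrt β * ((if a = b then plaquetteCurl (fun e' => if e' = e then (1 : ℝ) else 0) p else 0) + err)) 0 ∧
      err ^ 2 ≤ 32 * ∑ i : Fin 4, ((r.N : ℝ) - (r.ρ (axialFix U (plaquetteBoundary p i))).trace.re) := by
  have hGW : ∀ (t : ℝ) (y : Site 4), combTransport (Function.update U e
      ((combTransport U e.1)⁻¹ * k t * combTransport U e.1 * U e)) y = combTransport U y :=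
    fun t y => CombBasics.combTransport_update_of_not_isComb U hnc _ y
  exact assembly r b hk U e
    (fun t => Function.update U e ((combTransport U e.1)⁻¹ * k t * combTransport U e.1 * U e))
    (fun _ => False) True (fun e' => if e' = e then (1 : ℝ) else 0)
    (fun t e' hne => by
      have h1 : axialFix (Function.update U e ((combTransport U e.1)⁻¹ * k t * combTransport U e.1 * U e)) e' =
          axialFix U e' := by
        rw [CombBasics.axialFix_apply, CombBasics.axialFix_apply, hGW, hGW, Function.update_of_ne hne]
      simpa using h1)
    (fun t => by
      have h1 : axialFix (Function.update U e ((combTransport U e.1)⁻¹ * k t * combTransport U e.1 * U e)) e =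
          k t * axialFix U e := by
        rw [CombBasics.axialFix_apply, CombBasics.axialFix_apply, hGW, hGW, Function.update_self]
        group
      simpa using h1)
    (by simp)
    (fun e' hne => by simp [hne])
    β p a

/-- **RIGHT family, comb edge with `x_i < 0`** (`m = −ds − δ_e`; the comb transport of the shifted
configuration is supplied as the hypothesis `hGW`, from the neighbour stub `stub_combShift`). -/
theorem right_of_isComb [CompactSpace G] (U : LGConfig 4 G) (e : Literature.MathematicalPhysics.QuantumLattice.ZdEdge 4)
    (hc : ∀ j : Fin 4, e.2 < j → e.1 j = 0) (hx : e.1 e.2 < 0)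
    (hGW : ∀ (t : ℝ) (y : Site 4), combTransport (Function.update U e
      (U e * ((combTransport U (e.1 + Pi.single e.2 1))⁻¹ * (k t)⁻¹ *
        combTransport U (e.1 + Pi.single e.2 1)))) y =
        (if y ∈ shadow e then k t else 1) * combTransport U y)
    (β : ℝ) (p : ZdPlaquette 4) (a : Fin (lieDim r)) :
    ∃ err : ℝ, HasDerivAt (fun t : ℝ => plaqField r β (Function.update U e
        (U e * ((combTransport U (e.1 + Pi.single e.2 1))⁻¹ * (k t)⁻¹ *
          combTransport U (e.1 + Pi.single e.2 1)))) p a)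
        (Real.sqrt β * (-(if a = b then plaquetteCurl (fun e' => if e' = e then (1 : ℝ) else 0) p else 0) + err)) 0 ∧
      err ^ 2 ≤ 32 * ∑ i : Fin 4, ((r.N : ℝ) - (r.ρ (axialFix U (plaquetteBoundary p i))).trace.re) := by
  have hx0 : e.1 ∈ shadow e := ⟨hc, fun j _ => rfl, fun h => absurd hx (not_lt.2 h), fun _ => le_rfl⟩
  have hx1 : e.1 + Pi.single e.2 1 ∉ shadow e := fun h => by
    have h' := h.2.2.2 hx
    rw [Pi.add_apply, Pi.single_eq_same] at h'
    omega
  obtain ⟨err, hd, hb⟩ := assembly r b hk U e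
    (fun t => Function.update U e (U e * ((combTransport U (e.1 + Pi.single e.2 1))⁻¹ * (k t)⁻¹ *
      combTransport U (e.1 + Pi.single e.2 1))))
    (· ∈ shadow e) False
    (fun e' => -((if e' = e then (1 : ℝ) else 0) +
      ((if e'.1 + Pi.single e'.2 1 ∈ shadow e then (1 : ℝ) else 0) - (if e'.1 ∈ shadow e then 1 else 0))))
    (fun t e' hne => by
      rw [CombBasics.axialFix_apply, CombBasics.axialFix_apply, hGW, hGW, Function.update_of_ne hne]
      group)
    (fun t => by
      have h1 : axialFix (Function.update U e (U e * ((combTransport U (e.1 + Pi.single e.2 1))⁻¹ *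
          (k t)⁻¹ * combTransport U (e.1 + Pi.single e.2 1)))) e = 1 := by
        rw [CombBasics.axialFix_apply, hGW, hGW, Function.update_self, if_pos hx0, if_neg hx1,
          CombBasics.combTransport_add_single U hc]
        simp only [Prod.mk.eta]
        group
      rw [h1, CombBasics.axialFix_of_isComb U hc]
      simp)
    (by simp [hx0, hx1])
    (fun e' hne => by simp only [if_neg hne]; ring)
    β p a
  refine ⟨err, hd.congr_deriv ?_, hb⟩
  rw [plaquetteCurl_neg, plaquetteCurl_add, plaquetteCurl_gradient (fun y => if y ∈ shadow e then (1 : ℝ) else 0) p,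
    add_zero]
  split_ifs <;> ring

end Assembly

end TangentShiftDerivField

open TangentShiftDerivField in
/-- **Stub `stub_shiftDerivField` (TS3)** of line `Sketch` (crux `stmt-QuantumFields-8760`): along the
conjugated one-link shift `t ↦ T_t U` of the skew Haar shift (LEFT family for non-comb edges and comb
edges `(x, i)` with `x_i ≥ 0`, RIGHT family for comb edges with `x_i < 0`; comb transport of `T_t U`
from the neighbour stub `stub_combShift`, hypothesis `hTS0`), the rescaled plaquette field
`Y_p^a(T_t U)` is differentiable at `t = 0` with derivative `√β (±δ_ab (dδ_e)_p + err)`,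
`err² ≤ K Σ_i (N − Re tr ρ(Ũ_{∂_i p}))`, uniformly in `β, U, e, p, a` (`K = 32`). -/
theorem stub_shiftDerivField :
    ∀ (G : Type) [Group G] [TopologicalSpace G] [IsTopologicalGroup G] [CompactSpace G]
      (r : Literature.MathematicalPhysics.QuantumFieldTheory.LatticeRep G) (b : Fin (Summit.QuantumFields.YangMills.Theorems.EquipartitionPinsProbe.lieDim r)) (k : ℝ → G),
      (∀ t : ℝ, r.ρ (k t) = NormedSpace.exp ((t : ℂ) • Summit.QuantumFields.YangMills.Theorems.EquipartitionPinsProbe.lieVec r b)) →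
      (∀ (U : Literature.MathematicalPhysics.QuantumLattice.LGConfig 4 G) (e : Literature.MathematicalPhysics.QuantumLattice.ZdEdge 4) (k : G),
        ((∀ j : Fin 4, e.2 < j → e.1 j = 0) → 0 ≤ e.1 e.2 → ∀ y : Literature.Probability.LatticeModels.Site 4,
          Summit.QuantumFields.YangMills.Theorems.EquipartitionPinsProbe.combTransport (Function.update U e
              ((Summit.QuantumFields.YangMills.Theorems.EquipartitionPinsProbe.combTransport U e.1)⁻¹ * k * Summit.QuantumFields.YangMills.Theorems.EquipartitionPinsProbe.combTransport U e.1 * U e)) y =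
            (if y ∈ Summit.QuantumFields.YangMills.Theorems.EquipartitionPinsProbe.shadow e then k else 1) * Summit.QuantumFields.YangMills.Theorems.EquipartitionPinsProbe.combTransport U y) ∧
        ((∀ j : Fin 4, e.2 < j → e.1 j = 0) → e.1 e.2 < 0 → ∀ y : Literature.Probability.LatticeModels.Site 4,
          Summit.QuantumFields.YangMills.Theorems.EquipartitionPinsProbe.combTransport (Function.update U e
              (U e * ((Summit.QuantumFields.YangMills.Theorems.EquipartitionPinsProbe.combTransport U (e.1 + Pi.single e.2 1))⁻¹ * k⁻¹ *
                Summit.QuantumFields.YangMills.Theorems.EquipartitionPinsProbe.combTransport U (e.1 + Pi.single e.2 1)))) y =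
            (if y ∈ Summit.QuantumFields.YangMills.Theorems.EquipartitionPinsProbe.shadow e then k else 1) * Summit.QuantumFields.YangMills.Theorems.EquipartitionPinsProbe.combTransport U y) ∧
        (0 ≤ e.1 e.2 → ∀ g : G, Summit.QuantumFields.YangMills.Theorems.EquipartitionPinsProbe.combTransport (Function.update U e g) e.1 = Summit.QuantumFields.YangMills.Theorems.EquipartitionPinsProbe.combTransport U e.1) ∧
        (e.1 e.2 < 0 → ∀ g : G,
          Summit.QuantumFields.YangMills.Theorems.EquipartitionPinsProbe.combTransport (Function.update U e g) (e.1 + Pi.single e.2 1) =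
            Summit.QuantumFields.YangMills.Theorems.EquipartitionPinsProbe.combTransport U (e.1 + Pi.single e.2 1))) →
      ∃ K : ℝ, ∀ (β : ℝ) (U : Literature.MathematicalPhysics.QuantumLattice.LGConfig 4 G) (e : Literature.MathematicalPhysics.QuantumLattice.ZdEdge 4) (p : Literature.MathematicalPhysics.QuantumLattice.ZdPlaquette 4) (a : Fin (Summit.QuantumFields.YangMills.Theorems.EquipartitionPinsProbe.lieDim r)),
        (((¬ ∀ j : Fin 4, e.2 < j → e.1 j = 0) ∨ 0 ≤ e.1 e.2) → ∃ err : ℝ,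
          HasDerivAt (fun t : ℝ => Summit.QuantumFields.YangMills.Theorems.EquipartitionPinsProbe.plaqField r β (Function.update U e
              ((Summit.QuantumFields.YangMills.Theorems.EquipartitionPinsProbe.combTransport U e.1)⁻¹ * k t * Summit.QuantumFields.YangMills.Theorems.EquipartitionPinsProbe.combTransport U e.1 * U e)) p a)
            (Real.sqrt β * ((if a = b then Literature.MathematicalPhysics.QuantumFieldTheory.plaquetteCurl (fun e' => if e' = e then (1 : ℝ) else 0) p else 0) + err)) 0 ∧
          err ^ 2 ≤ K * ∑ i : Fin 4, ((r.N : ℝ) - (r.ρ (Summit.QuantumFields.YangMills.Theorems.EquipartitionPinsProbe.axialFix U (Literature.MathematicalPhysics.QuantumFieldTheory.plaquetteBoundary p i))).trace.re)) ∧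
        ((∀ j : Fin 4, e.2 < j → e.1 j = 0) → e.1 e.2 < 0 → ∃ err : ℝ,
          HasDerivAt (fun t : ℝ => Summit.QuantumFields.YangMills.Theorems.EquipartitionPinsProbe.plaqField r β (Function.update U e
              (U e * ((Summit.QuantumFields.YangMills.Theorems.EquipartitionPinsProbe.combTransport U (e.1 + Pi.single e.2 1))⁻¹ * (k t)⁻¹ *
                Summit.QuantumFields.YangMills.Theorems.EquipartitionPinsProbe.combTransport U (e.1 + Pi.single e.2 1)))) p a)
            (Real.sqrt β * (-(if a = b then Literature.MathematicalPhysics.QuantumFieldTheory.plaquetteCurl (fun e' => if e' = e then (1 : ℝ) else 0) p else 0) + err)) 0 ∧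
          err ^ 2 ≤ K * ∑ i : Fin 4, ((r.N : ℝ) - (r.ρ (Summit.QuantumFields.YangMills.Theorems.EquipartitionPinsProbe.axialFix U (Literature.MathematicalPhysics.QuantumFieldTheory.plaquetteBoundary p i))).trace.re)) := by
  intro G _ _ _ _ r b k hk hTS0
  refine ⟨32, fun β U e p a => ⟨fun h => ?_, fun hc hx => ?_⟩⟩
  · by_cases hc : ∀ j : Fin 4, e.2 < j → e.1 j = 0
    · have hx : 0 ≤ e.1 e.2 := h.resolve_left fun h' => h' hc
      exact left_of_isComb r b hk U e hc hx (fun t y => (hTS0 U e (k t)).1 hc hx y) β p a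
    · exact left_of_not_isComb r b hk U e hc β p a
  · exact right_of_isComb r b hk U e hc hx (fun t y => (hTS0 U e (k t)).2.1 hc hx y) β p a

end Summit.QuantumFields.YangMills.Theorems.EquipartitionPinsProbe

end
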